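import Summits.QuantumAdvantage.QuantumAdvantage.Theorems.CubicForrelationNearExactIsExactTwelveLevelFiveRigidDead
import Summits.QuantumAdvantage.QuantumAdvantage.Theorems.CubicForrelationNearExactIsExactTwelveLevelFiveAlphaFlat

/-!
# Crux `CubicForrelation.NearExactIsExact` (stmt-QuantumAdvantage-14043) — n = 12: THE SHAPE OF A SIDE ON THE OPEN WINDOW `(57/64, 29/32)`
  after gen 29 (packaging)

Certificate seat `b2b-cforr-cert` (gen 29).  HONEST FRAMING: packaging (standard axioms) of the gen 27–29 finite-slice theorems about cubic Boolean
pairs on 12 bits; it supersedes `tz27_window_side_shape` by removing the rigid level-5 alternative (`tzv_rigid_window_false`).  NO value of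
`θ₁₂` is claimed (`θ₁₂ ∈ [57/64, 14847/16384]` unchanged); NOT summit progress.

* `tz29_window_side_shape`: cubic `f, g` with `57/64 < Φ(f,g) < 1` ⇒ `W_g = 16u` with EITHER every `u(x)` odd (type O) OR `u = 2u'` with `u'`
  odd somewhere (level 5) and some point with `u'` even and `4 ∤ u' − 2(−1)^f` (case α).
* `tz29_window_side_alpha_data`: in the second case the case-α data of `tza_window_alpha` (the odd hyperplane `x₀ ⊕ V`, its complement
  `c ⊕ V`, and the 8-flat `A₂ = c ⊕ V₁`, `#V₁ = 256`, off-hyperplane energy `≥ 1024`, total slack `≤ 1535`).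
By the symmetry `Φ(f,g) = Φ(g,f)` the same holds for `f`.  What is left on the window: pairings of type-O and level-5-α sides
(HOME/b2b-cforr-cert-g29/PLAN-N12-WINDOW-ALPHA.md).

References: the tree files cited; MacWilliams–Sloane (1977) Ch. 13–15.  Axioms: the standard three.
-/

set_option linter.dupNamespace false -- D-0017: single-problem summit ⇒ `QuantumAdvantage.QuantumAdvantage` by design

noncomputable section

namespace Summit.QuantumAdvantage.QuantumAdvantage.Theorems.CubicForrelation.NearExactIsExact

open Finset
open Literature.Computability.QuantumComplexity
open Literature.Computability.QuantumComplexity.BuzetChailloux (bxor zeroVec bxor_bxor_cancel_left bxor_zeroVec zeroVec_bxor bxor_comm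
  bxor_self)
open Literature.Computability.QuantumComplexity.DerivativeWalsh (W)

/-- **The shape of a side on the open window after gen 29**: cubic `f, g` on 12 bits with `57/64 < Φ(f,g) < 1`.  Then `W_g = 16u` with EITHER
every `u(x)` odd (type O), OR `W_g = 32u'` (`u' = u/2`) with `u'` odd somewhere and some point where `u'` is even and `4 ∤ u' − 2(−1)^f`
(level 5, case α).  The generic and rigid level-5 configurations and level `≥ 6` are excluded by gens 27–29.  Finite-slice statement, NOT summit
progress. [this work] -/
theorem tz29_window_side_shape (f g : (Fin (6 + 6) → Bool) → Bool) (hf : IsDegLeFun 3 f) (hg : IsDegLeFun 3 g)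
    (hlo : (57 / 64 : ℝ) < forrelation f g) (hhi : forrelation f g < 1) :
    ∃ u : (Fin (6 + 6) → Bool) → ℤ, (∀ x, W (fun y => signOf (g y)) x = (2 : ℝ) ^ 4 * (u x : ℝ)) ∧
      ((∀ x, Odd (u x)) ∨
       ((∀ x, W (fun y => signOf (g y)) x = (2 : ℝ) ^ 5 * (((u x / 2 : ℤ)) : ℝ)) ∧ (∃ x, Odd (u x / 2)) ∧
        ∃ y, ¬ Odd (u y / 2) ∧ ¬ (4 : ℤ) ∣ u y / 2 - 2 * sZ (f y))) := by
  obtain ⟨u, hu, hcases⟩ := tz27_window_side_shape f g hf hg hlo hhi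
  refine ⟨u, hu, ?_⟩
  rcases hcases with hO | ⟨hu5, h5, -⟩
  · exact Or.inl hO
  · exact Or.inr ⟨hu5, h5, tzv_levelFive_window_alpha f g hf hg (fun x => u x / 2) hu5 h5 hlo hhi⟩

/-- **Case-α data of a level-5 side on the window** (packaging `tz29_window_side_shape` + `tza_window_alpha`): cubic `f, g` on 12 bits,
`57/64 < Φ(f,g) < 1`, `W_g = 32u'` with some `u'` odd.  Then the odd set of `u'` is a hyperplane `x₀ ⊕ V` (`#V = 2048`), its complement is
`c ⊕ V` with `u'(c)` even and `4 ∤ e₅(c)`, the set `{u' even, 4 ∤ e₅}` is the 8-flat `c ⊕ V₁` (`V₁ ⊆ V` xor-closed, `#V₁ = 256`), the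
off-hyperplane energy is `≥ 1024` and the total slack `Σ_P (e₅² − 1) + Σ_{off P} e₅²` is `≤ 1535` (`e₅ = u' − 2(−1)^f`).  Finite-slice
statement, NOT summit progress. [this work] -/
theorem tz29_window_side_alpha_data (f g : (Fin (6 + 6) → Bool) → Bool) (hf : IsDegLeFun 3 f) (hg : IsDegLeFun 3 g)
    (u' : (Fin (6 + 6) → Bool) → ℤ) (hu' : ∀ x, W (fun y => signOf (g y)) x = (2 : ℝ) ^ 5 * (u' x : ℝ)) (hodd : ∃ x, Odd (u' x))
    (hlo : (57 / 64 : ℝ) < forrelation f g) (hhi : forrelation f g < 1) :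
    ∃ (V : Finset (Fin (6 + 6) → Bool)) (x₀ c : Fin (6 + 6) → Bool) (V₁ : Finset (Fin (6 + 6) → Bool)),
      zeroVec ∈ V ∧ (∀ a ∈ V, ∀ b ∈ V, bxor a b ∈ V) ∧ #V = 2048 ∧
      (univ.filter fun x : Fin (6 + 6) → Bool => Odd (u' x)) = V.image (bxor x₀) ∧
      ¬ Odd (u' c) ∧ ¬ (4 : ℤ) ∣ u' c - 2 * sZ (f c) ∧
      (univ.filter fun x : Fin (6 + 6) → Bool => ¬ Odd (u' x)) = V.image (bxor c) ∧
      V₁ ⊆ V ∧ zeroVec ∈ V₁ ∧ (∀ a ∈ V₁, ∀ b ∈ V₁, bxor a b ∈ V₁) ∧ #V₁ = 256 ∧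
      (univ.filter fun y : Fin (6 + 6) → Bool => ¬ Odd (u' y) ∧ ¬ (4 : ℤ) ∣ u' y - 2 * sZ (f y)) = V₁.image (bxor c) ∧
      (∀ v ∈ V₁, ∀ y, ¬ Odd (u' y) →
        ((4 : ℤ) ∣ u' (bxor y v) - 2 * sZ (f (bxor y v)) ↔ (4 : ℤ) ∣ u' y - 2 * sZ (f y))) ∧
      1024 ≤ ∑ y ∈ univ.filter (fun y : Fin (6 + 6) → Bool => ¬ Odd (u' y)), (u' y - 2 * sZ (f y)) ^ 2 ∧
      ∑ x ∈ univ.filter (fun x : Fin (6 + 6) → Bool => Odd (u' x)), ((u' x - 2 * sZ (f x)) ^ 2 - 1) +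
        ∑ y ∈ univ.filter (fun y : Fin (6 + 6) → Bool => ¬ Odd (u' y)), (u' y - 2 * sZ (f y)) ^ 2 ≤ 1535 :=
  tza_window_alpha f g hf hg u' hu' hodd hlo (tzv_levelFive_window_alpha f g hf hg u' hu' hodd hlo hhi)

end Summit.QuantumAdvantage.QuantumAdvantage.Theorems.CubicForrelation.NearExactIsExact

end
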